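import Summits.ABC.IUTFork.Repair.CandJoshi24Schema
import Summits.ABC.IUTFork.Repair.EvalCoarseProfile
import HarnessLib

/-!
# IUT REPAIR branch, §A on the VAL(U) family, II — the POSSIBLE-image rows at the pole `¼ ∈ U`: TRUE, and COEXTENSIVE WITH S
# (abc-iut-rp-cx, gen 2)

PROOF-ONLY record file (no definition, no `Prop` fact; inputs consumed BY NAME) of the abc-iut cell, IUT REPAIR branch (rung LADDER-ABC:A2.RP;
lead abc-iut-rp-plan), seat abc-iut-rp-cx (refuter; T-b/T-c engine); sequel to `EvalValUProfile` (p443882: the KUMMER-image rows X04a, C01-VT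
are FALSE for EVERY `U`). TAKES NO SIDE on [IUTchIII] Cor. 3.12 or on any author (Mochizuki / Scholze–Stix / Joshi / Dupuy–Hilado); candidates
are hypotheses H with «H ∧ interface ⊢ Cor 3.12» as the target shape; typed ≠ proved; model data ≠ intended objects.

WHAT. On abc-iut-rp-j2's value-chart family `CandJoshi24.uSetting p U` (`U ≤ ℚˣ` inside the positive rationals, reading `uRho`, honest
q-datum `uQDatum`), rp-j2's schema `CandJoshi24Schema.u_residual_iff` (p444568) prices the residual: S ⟺ `¼ ∈ U`. With the bed's (ii)(b) and
pins BY NAME (`u_kummerB`, `u_pinnedRegions3`) and abc-iut-w5-d230's `reading3_iff_pilotKummerIndRelated`, READING R3 («the q-pilot region is a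
possible image of the Θ-pilot at every packet») is therefore ⟺ `¼ ∈ U` (`valU_reading3_iff`). Consequences for the POSSIBLE-image rows of §A
at the pole `¼ ∈ U`: RP-L01 ✓ for every `ρ qK` (`l01_valU_of_quarter`, abc-iut-rp-l1's `CandLana1.H_of_reading3`), RP-M32a/b/c ✓ for every
`ρ qK` (`m32_valU_of_quarter`, abc-iut-rp-m3's `H_iff_reading3` / `H'_of_H` / `H''_of_H`), RP-J02 ✓ (`j02_valU_of_quarter`) — and AT THE SAME
POLE S HOLDS (`possibleRows_coextensive_with_S`): on this family the possible-image rows are TRUE exactly where they are NOT NEEDED (no SAT⁺-with-¬S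
witness arises here), matching §J's split (they are TRUE only where Step (x) log-volume invariance fails — here `U ≠ ⊥`,
`CandJoshi24Schema.u_logvolInvariant_iff`). The other pole (`¼ ∉ U`, in particular the honest `U = ⊥`) is decided by the hull side of the
schema (rp-j2's announced `CandJoshi24Hull`) and is not typed here. Interface-level toy (`toyIndex`, `l⋇ = 2`); Joshi's valuation-multiplicative
typing of (Ind1)/(Ind2), not [IUTchIII]'s isometries; no judgement on print. [claim: Mochizuki2012, status: disputed]
[claim: Joshi2023ATS2Local, status: disputed] [cite: ScholzeStix2018, §2.2 pp. 9–10]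
-/

noncomputable section

open Set

namespace Summit.ABC.IUTFork.Repair.EvalValUPossible

open Cor312 Cor312.Checks Cor312.IdentifiedNonVacuity Cor312Vol Cor312Vol.NaiveWitness Cor312Vol.UnitWitness
  Cor312Vol.PinnedWitness Literature.IUT.LogThetaLattice Summit.ABC.IUTFork.Repair Summit.ABC.IUTFork.Repair.ScalarShells
  Summit.ABC.IUTFork.Repair.ScalarShellsThm311 Summit.ABC.IUTFork.Repair.CandJoshi24
open Thm311 hiding toyIndex

variable (p : ℕ) {U : Subgroup ℚˣ} (hU : U ≤ Units.posSubgroup ℚ)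

include hU

/-! ## 1. Reading R3 on the family -/

/-- **READING R3 on VAL(U) ⟺ `¼ ∈ U`** (pins + (ii)(b) BY NAME, then rp-j2's `u_residual_iff`). [claim: Joshi2023ATS2Local, status: disputed] -/
theorem valU_reading3_iff :
    (∀ (j : toyIndex.Label) (vQ : toyIndex.VQ), (uSetting p U).qRegion j vQ ∈ (uSetting p U).possibleImages j vQ) ↔
      CandJoshi23.quarter ∈ U :=
  (reading3_iff_pilotKummerIndRelated _ _ _ _ (u_kummerB p U 0) (u_pinnedRegions3 p U hU).1).trans (u_residual_iff p U hU)

/-! ## 2. The possible-image rows at the pole `¼ ∈ U` — all TRUE -/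

variable (ρ : (∀ v : toyIndex.V, v ∈ toyIndex.Vbad → Set ((uShells p U).StarPacket v)) →
    ∀ (j : toyIndex.Label) (vQ : toyIndex.VQ), Set ((uShells p U).Packet j vQ))
  (qK : ∀ v : toyIndex.V, v ∈ toyIndex.Vbad → Set ((uShells p U).StarPacket v))

/-- **RP-L01 ✓ on VAL(U) when `¼ ∈ U`**, for every `ρ`, `qK` (global image choice «the q-region everywhere»). [folklore] -/
theorem l01_valU_of_quarter (hq : CandJoshi23.quarter ∈ U) : CandLana1.H (uFull p U).toLatticeSituation (uSetting p U) ρ qK :=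
  CandLana1.H_of_reading3 _ _ ρ qK fun i vQ => (valU_reading3_iff p hU).2 hq (Setting.labelSucc i) vQ

/-- **RP-M32a ✓, M32b ✓, M32c ✓ on VAL(U) when `¼ ∈ U`**, for every `ρ`, `qK`. [folklore] -/
theorem m32_valU_of_quarter (hq : CandJoshi23.quarter ∈ U) :
    CandMochizuki32.H (uFull p U).toLatticeSituation (uSetting p U) ρ qK ∧
      CandMochizuki32.H' (uFull p U).toLatticeSituation (uSetting p U) ρ qK ∧
      CandMochizuki32.H'' (uFull p U).toLatticeSituation (uSetting p U) ρ qK :=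
  have h : CandMochizuki32.H (uFull p U).toLatticeSituation (uSetting p U) ρ qK :=
    (CandMochizuki32.H_iff_reading3 _ _ ρ qK).2 ((valU_reading3_iff p hU).2 hq)
  ⟨h, CandMochizuki32.H'_of_H _ _ ρ qK h, CandMochizuki32.H''_of_H _ _ ρ qK h⟩

omit ρ qK in
/-- **RP-J02 ✓ on VAL(U) when `¼ ∈ U`** (from M32b, cx `h'_imp_joshiVolumeDominance`). [folklore] -/
theorem j02_valU_of_quarter (hq : CandJoshi23.quarter ∈ U) : CandJoshi1.JoshiVolumeDominance (uSetting p U) :=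
  EvalCoarseProfile.h'_imp_joshiVolumeDominance _ _ (uRho p U) (uQDatum p U) (m32_valU_of_quarter p hU (uRho p U) (uQDatum p U) hq).2.1

/-! ## 3. Coextension with S at this pole -/

/-- **At the pole `¼ ∈ U` the possible-image rows hold TOGETHER WITH S** (for the bed's own reading `uRho`, `uQDatum`): L01 ∧ M32b ∧ J02 ∧
`PilotKummerIndRelated`. So VAL(U) yields no SAT⁺-with-`¬S` witness for these rows: they are true exactly where the residual already holds.
[claim: Joshi2023ATS2Local, status: disputed] -/
theorem possibleRows_coextensive_with_S (hq : CandJoshi23.quarter ∈ U) :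
    CandLana1.H (uFull p U).toLatticeSituation (uSetting p U) (uRho p U) (uQDatum p U) ∧
      CandMochizuki32.H' (uFull p U).toLatticeSituation (uSetting p U) (uRho p U) (uQDatum p U) ∧
      CandJoshi1.JoshiVolumeDominance (uSetting p U) ∧
      PilotKummerIndRelated (uFull p U).toLatticeSituation (uSetting p U) (uRho p U) (uQDatum p U) :=
  ⟨l01_valU_of_quarter p hU _ _ hq, (m32_valU_of_quarter p hU _ _ hq).2.1, j02_valU_of_quarter p hU hq, (u_residual_iff p U hU).2 hq⟩

/-- **Conversely, wherever S FAILS on the family (`¼ ∉ U`), READING R3 fails** — the level-R readings (L01's source, M32a) lose their witness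
«the q-region itself»; whether a DIFFERENT possible image of equal volume exists there is the hull side (not typed here). [folklore] -/
theorem not_reading3_of_not_quarter (hq : CandJoshi23.quarter ∉ U) :
    ¬ (∀ (j : toyIndex.Label) (vQ : toyIndex.VQ), (uSetting p U).qRegion j vQ ∈ (uSetting p U).possibleImages j vQ) :=
  fun h => hq ((valU_reading3_iff p hU).1 h)

/-- … in particular RP-M32a (`CandMochizuki32.H`, level R) is FALSE wherever `¼ ∉ U`, for every `ρ`, `qK`. [folklore] -/
theorem m32a_false_of_not_quarter (hq : CandJoshi23.quarter ∉ U) : ¬ CandMochizuki32.H (uFull p U).toLatticeSituation (uSetting p U) ρ qK :=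
  fun h => not_reading3_of_not_quarter p hU hq ((CandMochizuki32.H_iff_reading3 _ _ ρ qK).1 h)

end Summit.ABC.IUTFork.Repair.EvalValUPossible

end
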